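import Summits.QuantumFields.YangMills.Theorems.PoincareLipschitzSphereMapEnergyDecayOfComparison
import Summits.QuantumFields.YangMills.Theorems.PoincareLipschitzSphereMapMinimalitySplit
import Summits.QuantumFields.YangMills.Theorems.PoincareLipschitzSphereMapRingNearSphere
import Summits.QuantumFields.YangMills.Theorems.PoincareLipschitzSphereMapVarRadiusMollifier
import Summits.QuantumFields.YangMills.Theorems.PoincareLipschitzSphereMapTentSupport

/-!
# Line «poincare_lipschitz» on crux `HistoryTailL` (stmt-QuantumFields-19936), route crux `BlockLipschitzL` (stmt-QuantumFields-23533), K2 organ of record LOC-REG-MIN —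
# FLAT SHADOW «ENERGY → RANGE» (E→R) FOR LATTICE MINIMISERS INTO A SPHERE, FILE 5d-E: THE ONE-STEP IMPROVEMENT AT FIXED GEOMETRY —
# for a unit-sphere-valued minimiser on `Q_r(z)` and ANY bond-Lipschitz comparable radius function supported in the band `R_in + 4 ≤ ‖·−z‖_∞ ≤ r′ − 4` and constant `= s` on the
# ring `‖·−z‖_∞ = R`: `E(u; Q_ρ) ≤ 2A_d((ρ+1)∕(R−1))^d·E(u;Q_R) + 2·(Λ′ + (m⁻²−1)·E(u;Q_R) + m⁻²·(2√(E(u;Q_R)·X′) + X′))` with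
# `Λ′ = 4C·E_U`, `X′ = (2C + 2)·E_U`, `E_U = E(u; Q_{r′−1}(z) ∖ Q_{R_in}(z))`, `C = d·(2+4d)²·d·21^d·(A+B+1)^d` — every smallness now a BAND ENERGY or the ring defect `1 − m`

Cell `ym3-torus` (YM ladder rung R3 = continuum SU(2) Yang–Mills on the three-torus — a RUNG, NOT the Clay problem: not d = 4, not infinite volume, not a mass gap); width seat
`ym-ust-19936-w5` gen 12 (LEAD ym-ust-19936-w1 g8 2026-08-29T05:29:02Z END-GAME «[C] = E→R F5 (★w5) + F6 (px8)»; my LOCATE `E2R-ROAD-w5g12.md` §2 (i)–(vii)).  THEOREMS ONLY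
(def-free), `V` a finite-dimensional real inner-product space, lattice letters of lit ✓`B4Eq19LatticeOperators`; THE ASSEMBLY of ★w5 g12's ✓F4 `energy_mollifier_le`, ✓F5d-A
`energy_decay_of_comparison` + `exists_vec_harmonic_extension`, ✓F5d-B `minimality_split` + `layer_cost_le_four_mul`, ✓F5d-C `norm_harmonicExt_ge_of_ring`, ✓F5d-D
`energy_sub_le_on_support` + sup-distance letters (✓F5a); `--supports stmt-QuantumFields-19936`.  Nothing here proves px8's socket `hone` yet (the band energies `E_U`, `1 − m` and
`‖c‖ ≥ ½` are still DISPLAYED — F5d-F discharges them from the multi-scale good shell), nor E→R, LOC-REG-MIN, `hReg`, `hImprove`, a stub, `BlockLipschitzL`, `HistoryTailL` or a summit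
statement.
* ★★★ `oneStep_fixedGeometry` — the title statement (hypotheses listed in its docstring); ★★★ `oneStep_fixedGeometry_of_slack` — the same with `E(u) ≤ E(w) + sl` (twist slack), `+ 2sl`.
[folklore] ([SchoenUhlenbeck1982] §4 (energy improvement for minimisers); the lattice statement is this file's).
-/

set_option autoImplicit false

noncomputable section

open scoped BigOperators InnerProductSpace
open Finset

namespace Summit.QuantumFields.YangMills.Theorems.PoincareLipschitzSphereMapOneStepFixedGeometry

open Literature.MathematicalPhysics.QuantumFieldTheory.Balaban1983to89
open B4Eq19LatticeOperators
open Summit.QuantumFields.YangMills.Theorems.PoincareLipschitzSphereMapEnergyDecayOfComparison (exists_vec_harmonic_extension energy_decay_of_comparison)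
open Summit.QuantumFields.YangMills.Theorems.PoincareLipschitzSphereMapMinimalitySplit (minimality_split minimality_split_of_slack layer_cost_le_four_mul)
open Summit.QuantumFields.YangMills.Theorems.PoincareLipschitzSphereMapRingNearSphere (norm_harmonicExt_ge_of_ring)
open Summit.QuantumFields.YangMills.Theorems.PoincareLipschitzSphereMapVarRadiusMollifier (energy_mollifier_le)
open Summit.QuantumFields.YangMills.Theorems.PoincareLipschitzSphereMapTentSupport (energy_sub_le_on_support mean_eq_self_of_radius_eq_zero)
open Summit.QuantumFields.YangMills.Theorems.PoincareLipschitzSphereMapDepthRadius (mem_box_iff_sup_le abs_sup_sub_sup_le_of_mem_box)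

variable {d : ℕ} {V : Type*} [NormedAddCommGroup V] [InnerProductSpace ℝ V]

/-- ★★★ **THE ONE-STEP IMPROVEMENT AT FIXED GEOMETRY.**  DATA: `d ≥ 1`, `V` finite-dimensional; `u : ℤ^d → V` with `‖u‖ = 1` everywhere, MINIMISING on `Q_r(z)` among unit
fields agreeing with it off `Q_{r−1}(z)` (`hminU`); radii `1 ≤ R`, `R ≤ r′ ≤ r`, `R_in`, `s ≥ 0`; a radius function `σ ≥ 0`, bond-Lipschitz (`|σ(y+e_μ) − σ(y)| ≤ 1`),
comparable (`σ x ≤ A·σ x′ + B` when `Q_{σx+2}(x)`, `Q_{σx′+2}(x′)` meet, `A ≥ 1`), supported in the band (`σ y ≠ 0 ⇒ R_in + 4 ≤ ‖y−z‖_∞ ≤ r′ − 4`), `= s` on the ring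
`‖y−z‖_∞ = R`, with `Q_{σy+2}(y) ⊆ U := Q_{r′−1}(z) ∖ Q_{R_in}(z)` for `R_in + 3 ≤ ‖y−z‖_∞ ≤ r′ − 3` (the tent of ✓F5d-D is such a σ); the mollified field
`c y = (#Q_{σy}(y))⁻¹ • Σ_{Q_{σy}(y)} u`; SMALLNESS DISPLAYED: `‖c‖ ≥ ½` everywhere, `m ≤ ‖c‖` on `Q_{R+1}(z) ∖ Q_{R−1}(z)`, `0 < m ≤ 1`, and
`m ≤ 1 − (2dR·√((2s+1)^{−d}·E′) + 2(2s+1)·√(d·(2s+1)^{−d}·E′))`, `E′ = E(u; Q_{R+s+1}(z))`.  CONCLUSION, for `0 ≤ ρ ≤ R − 2`, with `E_R = E(u;Q_R(z))`,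
`E_U = E(u; Q_{r′−1}(z) ∖ Q_{R_in}(z))`, `C = d·((2+4d)²·d·21^d)·(A+B+1)^d`, `A_d = 2^d(1+56d)^d(8(d+1))^{d+1}`:
`E(u; Q_ρ(z)) ≤ 2A_d((ρ+1)∕((R−2)+1))^d·E_R + 2·(4C·E_U + (m⁻² − 1)·E_R + m⁻²·(2√(E_R·(2C+2)E_U) + (2C+2)E_U))`.
PROOF: harmonic extensions `H` of `c` and `h′` of `u` into `Q_{R−1}` (✓`exists_vec_harmonic_extension`); `‖H‖ ≥ m` on `Q_R` (✓`norm_harmonicExt_ge_of_ring`) and on the forward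
neighbours (`H = c` there); competitor `π∘H` via ✓`minimality_split`; layer cost `≤ 4E(c; X_out) ≤ 4C·E_U` (✓`layer_cost_le_four_mul` ∘ ✓`energy_mollifier_le`, the boxes of
`X_out` lie in `U` because `c ≠ u` forces `σ ≠ 0` nearby); `X ≤ 2E(c;T) + 2E(u;T) ≤ (2C+2)E_U` (✓`energy_sub_le_on_support` ∘ ✓`energy_mollifier_le`, `T ⊆ U`); then
✓`energy_decay_of_comparison` and monotonicity in `Λ, X`. [folklore] [cite: SchoenUhlenbeck1982, §4] -/
theorem oneStep_fixedGeometry [FiniteDimensional ℝ V] (hd : 0 < d) (u c : Zd d → V) (σ : Zd d → ℤ) (z : Zd d) {r r' R Rin s : ℤ}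
    (hu : ∀ y, ‖u y‖ = 1) (hc : ∀ y, c y = (((box y (σ y)).card : ℝ))⁻¹ • ∑ w ∈ box y (σ y), u w)
    (hσ0 : ∀ y, 0 ≤ σ y) (hσL : ∀ y, ∀ μ : Fin d, |σ (y + unitVec μ) - σ y| ≤ 1) {A B : ℕ} (hA : 1 ≤ A)
    (hσC : ∀ x x' y : Zd d, y ∈ box x (σ x + 2) → y ∈ box x' (σ x' + 2) → σ x ≤ (A : ℤ) * σ x' + B)
    (hσband : ∀ y, σ y ≠ 0 → Rin + 4 ≤ ((Finset.univ.sup fun j => (y j - z j).natAbs : ℕ) : ℤ) ∧ ((Finset.univ.sup fun j => (y j - z j).natAbs : ℕ) : ℤ) ≤ r' - 4)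
    (hσbox : ∀ y, Rin + 3 ≤ ((Finset.univ.sup fun j => (y j - z j).natAbs : ℕ) : ℤ) → ((Finset.univ.sup fun j => (y j - z j).natAbs : ℕ) : ℤ) ≤ r' - 3 →
      box y (σ y + 2) ⊆ box z (r' - 1) \ box z Rin)
    (hσring : ∀ y, ((Finset.univ.sup fun j => (y j - z j).natAbs : ℕ) : ℤ) = R → σ y = s) (hs : 0 ≤ s)
    (hR1 : 1 ≤ R) (hRr' : R ≤ r') (hr'r : r' ≤ r)
    (hminU : ∀ w : Zd d → V, (∀ y, ‖w y‖ = 1) → (∀ y ∉ box z (r - 1), w y = u y) →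
      ∑ y ∈ box z r, ∑ μ, ‖u (y + unitVec μ) - u y‖ ^ 2 ≤ ∑ y ∈ box z r, ∑ μ, ‖w (y + unitVec μ) - w y‖ ^ 2)
    (hhalf : ∀ y, (1 / 2 : ℝ) ≤ ‖c y‖) {m : ℝ} (hm : 0 < m) (hm1 : m ≤ 1)
    (hmc : ∀ y ∈ box z (R + 1), y ∉ box z (R - 1) → m ≤ ‖c y‖)
    (hmH : m ≤ 1 - (2 * d * R * Real.sqrt (((((2 * s + 1 : ℤ) : ℝ) ^ d))⁻¹ * ∑ w ∈ box z (R + s + 1), ∑ μ, ‖u (w + unitVec μ) - u w‖ ^ 2) +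
        2 * ((2 * s + 1 : ℤ) : ℝ) * Real.sqrt (d * ((((2 * s + 1 : ℤ) : ℝ) ^ d))⁻¹ * ∑ w ∈ box z (R + s + 1), ∑ μ, ‖u (w + unitVec μ) - u w‖ ^ 2)))
    {ρ : ℤ} (hρ : 0 ≤ ρ) (hρR : ρ ≤ R - 2) :
    ∑ y ∈ box z ρ, ∑ μ, ‖u (y + unitVec μ) - u y‖ ^ 2 ≤
      2 * ((2 : ℝ) ^ d * (1 + 56 * d) ^ d * (8 * ((d : ℝ) + 1)) ^ (d + 1) * (((ρ : ℝ) + 1) / (((R - 2 : ℤ) : ℝ) + 1)) ^ d) *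
          ∑ y ∈ box z R, ∑ μ, ‖u (y + unitVec μ) - u y‖ ^ 2 +
        2 * (4 * ((d : ℝ) * ((2 + 4 * (d : ℝ)) ^ 2 * d * (21 : ℝ) ^ d) * ((A : ℝ) + B + 1) ^ d) * ∑ y ∈ box z (r' - 1) \ box z Rin, ∑ μ, ‖u (y + unitVec μ) - u y‖ ^ 2 +
          ((m ^ 2)⁻¹ - 1) * ∑ y ∈ box z R, ∑ μ, ‖u (y + unitVec μ) - u y‖ ^ 2 +
          (m ^ 2)⁻¹ * (2 * Real.sqrt ((∑ y ∈ box z R, ∑ μ, ‖u (y + unitVec μ) - u y‖ ^ 2) *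
              ((2 * ((d : ℝ) * ((2 + 4 * (d : ℝ)) ^ 2 * d * (21 : ℝ) ^ d) * ((A : ℝ) + B + 1) ^ d) + 2) *
                ∑ y ∈ box z (r' - 1) \ box z Rin, ∑ μ, ‖u (y + unitVec μ) - u y‖ ^ 2)) +
            (2 * ((d : ℝ) * ((2 + 4 * (d : ℝ)) ^ 2 * d * (21 : ℝ) ^ d) * ((A : ℝ) + B + 1) ^ d) + 2) *
              ∑ y ∈ box z (r' - 1) \ box z Rin, ∑ μ, ‖u (y + unitVec μ) - u y‖ ^ 2)) := by
  classical
  -- names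
  set D : Zd d → ℤ := fun y => ((Finset.univ.sup fun j => (y j - z j).natAbs : ℕ) : ℤ) with hD
  set U : Finset (Zd d) := box z (r' - 1) \ box z Rin with hU
  set EU : ℝ := ∑ y ∈ U, ∑ μ, ‖u (y + unitVec μ) - u y‖ ^ 2 with hEU
  set ER : ℝ := ∑ y ∈ box z R, ∑ μ, ‖u (y + unitVec μ) - u y‖ ^ 2 with hER
  set Cst : ℝ := (d : ℝ) * ((2 + 4 * (d : ℝ)) ^ 2 * d * (21 : ℝ) ^ d) * ((A : ℝ) + B + 1) ^ d with hCst
  have hCst0 : 0 ≤ Cst := by positivity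
  have hEU0 : 0 ≤ EU := Finset.sum_nonneg fun _ _ => Finset.sum_nonneg fun _ _ => by positivity
  have hER0 : 0 ≤ ER := Finset.sum_nonneg fun _ _ => Finset.sum_nonneg fun _ _ => by positivity
  -- (a) radius zero ⇒ `c = u`; hence `c ≠ u ⇒ σ ≠ 0`
  have hcu0 : ∀ y, σ y = 0 → c y = u y := fun y hy => by rw [hc y]; exact mean_eq_self_of_radius_eq_zero u y hy
  have hσ_of_ne : ∀ y, c y ≠ u y → σ y ≠ 0 := fun y hne h0 => hne (hcu0 y h0)
  -- (b) `c = u` off `Q_{r−1}(z)`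
  have hcu : ∀ y ∉ box z (r - 1), c y = u y := by
    intro y hy
    apply hcu0
    by_contra hne
    have hb := hσband y hne
    change Rin + 4 ≤ D y ∧ D y ≤ r' - 4 at hb
    have : ¬ D y ≤ r - 1 := fun h => hy ((mem_box_iff_sup_le hd y z (r - 1)).2 h)
    omega
  -- (c) the band of points where `c ≠ u` at the point or a forward neighbour
  have hband : ∀ y, (c y ≠ u y ∨ ∃ μ : Fin d, c (y + unitVec μ) ≠ u (y + unitVec μ)) → Rin + 3 ≤ D y ∧ D y ≤ r' - 3 := by
    intro y hP
    rcases hP with h | ⟨μ, h⟩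
    · have hb := hσband y (hσ_of_ne y h)
      change Rin + 4 ≤ D y ∧ D y ≤ r' - 4 at hb
      omega
    · have hb := hσband (y + unitVec μ) (hσ_of_ne _ h)
      change Rin + 4 ≤ D (y + unitVec μ) ∧ D (y + unitVec μ) ≤ r' - 4 at hb
      have hmem : y + unitVec μ ∈ box y 1 := by
        have := add_unitVec_mem_box (self_mem_box y le_rfl) μ; simpa using this
      have hdiff := abs_sup_sub_sup_le_of_mem_box hd z hmem
      rw [abs_le] at hdiff
      change -1 ≤ D y - D (y + unitVec μ) ∧ D y - D (y + unitVec μ) ≤ 1 at hdiff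
      omega
  -- (d) the harmonic extensions
  obtain ⟨H, hHc, hH⟩ := exists_vec_harmonic_extension hd z (R - 1) c
  obtain ⟨h', hh'u, hh'⟩ := exists_vec_harmonic_extension hd z (R - 1) u
  -- (e) ring points have `D = R`, hence `σ = s` and `c = ū_s`
  have hringD : ∀ y ∈ box z R, y ∉ box z (R - 1) → D y = R := by
    intro y hy hy'
    have h1 := (mem_box_iff_sup_le hd y z R).1 hy
    have h2 : ¬ D y ≤ R - 1 := fun h => hy' ((mem_box_iff_sup_le hd y z (R - 1)).2 h)
    change D y ≤ R at h1
    omega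
  have hringH : ∀ y ∈ box z R, y ∉ box z (R - 1) → H y = (((box y s).card : ℝ))⁻¹ • ∑ w ∈ box y s, u w := by
    intro y hy hy'
    rw [hHc y hy', hc y, hσring y (hringD y hy hy')]
  -- (f) `‖H‖ ≥ m` on `Q_R(z)` and on its forward neighbours
  have hmin_int : ∀ x ∈ box z R, m ≤ ‖H x‖ := by
    intro x hx
    have h := norm_harmonicExt_ge_of_ring hd u H z hR1 hs (fun y _ => hu y) hH hringH hx
    exact hmH.trans h
  have hmQ' : ∀ y ∈ box z R, ∀ μ : Fin d, m ≤ ‖H (y + unitVec μ)‖ := by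
    intro y hy μ
    by_cases hin : y + unitVec μ ∈ box z R
    · exact hmin_int _ hin
    · have hnot : y + unitVec μ ∉ box z (R - 1) := fun h => hin (box_mono z (by linarith) h)
      rw [hHc _ hnot]
      refine hmc _ ?_ hnot
      exact add_unitVec_mem_box hy μ
  have hH0 : ∀ y, H y ≠ 0 := by
    intro y
    by_cases hy : y ∈ box z R
    · have := hmin_int y hy
      intro h0; rw [h0, norm_zero] at this; linarith
    · have hnot : y ∉ box z (R - 1) := fun h => hy (box_mono z (by linarith) h)
      rw [hHc y hnot]
      intro h0; have := hhalf y; rw [h0, norm_zero] at this; linarith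
  -- (g) minimality split
  have hRr : R ≤ r := hRr'.trans hr'r
  have hsplit := minimality_split u c H z hRr hu hminU hH0 hHc hcu
  -- (h) layer cost
  set Pout : Zd d → Prop := fun y => c y ≠ u y ∨ ∃ μ : Fin d, c (y + unitVec μ) ≠ u (y + unitVec μ) with hPout
  set Xout : Finset (Zd d) := (box z r \ box z R).filter Pout with hXout
  have hXsub : Xout ⊆ box z r \ box z R := Finset.filter_subset _ _
  have hcuX : ∀ y ∈ (box z r \ box z R) \ Xout, c y = u y ∧ ∀ μ : Fin d, c (y + unitVec μ) = u (y + unitVec μ) := by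
    intro y hy
    rw [Finset.mem_sdiff, hXout, Finset.mem_filter] at hy
    have hP : ¬ Pout y := fun h => hy.2 ⟨hy.1, h⟩
    simp only [hPout, not_or, not_exists, not_not] at hP
    exact hP
  have hΛ := layer_cost_le_four_mul u c z hu Xout hXsub hcuX (fun y _ => hhalf y) (fun y _ μ => hhalf _)
  -- boxes of `Xout` and of `T` lie in `U`
  have hUX : ∀ y ∈ Xout, box y (σ y + 2) ⊆ U := by
    intro y hy
    rw [hXout, Finset.mem_filter] at hy
    have hb := hband y hy.2
    exact hσbox y hb.1 hb.2
  have hmollX := energy_mollifier_le u σ hσ0 A B hA hσC Xout U (fun y _ μ => hσL y μ) hUX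
  -- rewrite the mollifier sums as `c`
  have hcE : ∀ S : Finset (Zd d), ∑ x ∈ S, ∑ μ, ‖(((box (x + unitVec μ) (σ (x + unitVec μ))).card : ℝ))⁻¹ • ∑ y ∈ box (x + unitVec μ) (σ (x + unitVec μ)), u y -
        (((box x (σ x)).card : ℝ))⁻¹ • ∑ y ∈ box x (σ x), u y‖ ^ 2 = ∑ x ∈ S, ∑ μ, ‖c (x + unitVec μ) - c x‖ ^ 2 := by
    intro S
    refine Finset.sum_congr rfl fun x _ => Finset.sum_congr rfl fun μ _ => ?_
    rw [hc (x + unitVec μ), hc x]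
  rw [hcE] at hmollX
  have hΛ' : ∑ y ∈ box z r \ box z R, ∑ μ, ‖(‖c (y + unitVec μ)‖)⁻¹ • c (y + unitVec μ) - (‖c y‖)⁻¹ • c y‖ ^ 2 -
      ∑ y ∈ box z r \ box z R, ∑ μ, ‖u (y + unitVec μ) - u y‖ ^ 2 ≤ 4 * Cst * EU := by
    calc _ ≤ 4 * ∑ y ∈ Xout, ∑ μ, ‖c (y + unitVec μ) - c y‖ ^ 2 := hΛ
      _ ≤ 4 * (Cst * EU) := by linarith [hmollX]
      _ = 4 * Cst * EU := by ring
  -- (i) the `X`-slot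
  set T : Finset (Zd d) := (box z R).filter Pout with hT
  have hTmem : ∀ y ∈ box z R, Pout y → y ∈ T := fun y hy hP => by rw [hT, Finset.mem_filter]; exact ⟨hy, hP⟩
  have hXsplit := energy_sub_le_on_support c u (box z R) T hTmem
  have hUT : ∀ y ∈ T, box y (σ y + 2) ⊆ U := by
    intro y hy
    rw [hT, Finset.mem_filter] at hy
    have hb := hband y hy.2
    exact hσbox y hb.1 hb.2
  have hmollT := energy_mollifier_le u σ hσ0 A B hA hσC T U (fun y _ μ => hσL y μ) hUT
  rw [hcE] at hmollT
  have hTU : T ⊆ U := by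
    intro y hy
    rw [hT, Finset.mem_filter] at hy
    have hb := hband y hy.2
    rw [hU, Finset.mem_sdiff, mem_box_iff_sup_le hd, mem_box_iff_sup_le hd]
    change D y ≤ r' - 1 ∧ ¬ D y ≤ Rin
    omega
  have huT : ∑ y ∈ T, ∑ μ, ‖u (y + unitVec μ) - u y‖ ^ 2 ≤ EU :=
    Finset.sum_le_sum_of_subset_of_nonneg hTU fun _ _ _ => Finset.sum_nonneg fun _ _ => by positivity
  have hX' : ∑ y ∈ box z R, ∑ μ, ‖(c (y + unitVec μ) - u (y + unitVec μ)) - (c y - u y)‖ ^ 2 ≤ (2 * Cst + 2) * EU := by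
    calc _ ≤ _ := hXsplit
      _ ≤ 2 * (Cst * EU) + 2 * EU := by linarith [hmollT, huT]
      _ = (2 * Cst + 2) * EU := by ring
  -- (j) the decay from the comparison, then monotonicity in `Λ` and `X`
  have hdec := energy_decay_of_comparison u c h' H z hρ hρR hm hm1 hh' hh'u hH hHc hmin_int hmQ' hsplit
  set X : ℝ := ∑ y ∈ box z R, ∑ μ, ‖(c (y + unitVec μ) - u (y + unitVec μ)) - (c y - u y)‖ ^ 2 with hX
  have hX0 : 0 ≤ X := Finset.sum_nonneg fun _ _ => Finset.sum_nonneg fun _ _ => by positivity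
  have hm2 : 0 ≤ (m ^ 2)⁻¹ := by positivity
  have hsqrt : Real.sqrt (ER * X) ≤ Real.sqrt (ER * ((2 * Cst + 2) * EU)) := Real.sqrt_le_sqrt (mul_le_mul_of_nonneg_left hX' hER0)
  have hmono : (∑ y ∈ box z r \ box z R, ∑ μ, ‖(‖c (y + unitVec μ)‖)⁻¹ • c (y + unitVec μ) - (‖c y‖)⁻¹ • c y‖ ^ 2 -
        ∑ y ∈ box z r \ box z R, ∑ μ, ‖u (y + unitVec μ) - u y‖ ^ 2) +
      ((m ^ 2)⁻¹ - 1) * ER + (m ^ 2)⁻¹ * (2 * Real.sqrt (ER * X) + X) ≤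
      4 * Cst * EU + ((m ^ 2)⁻¹ - 1) * ER + (m ^ 2)⁻¹ * (2 * Real.sqrt (ER * ((2 * Cst + 2) * EU)) + (2 * Cst + 2) * EU) := by
    have h1 : (m ^ 2)⁻¹ * (2 * Real.sqrt (ER * X) + X) ≤ (m ^ 2)⁻¹ * (2 * Real.sqrt (ER * ((2 * Cst + 2) * EU)) + (2 * Cst + 2) * EU) :=
      mul_le_mul_of_nonneg_left (by linarith) hm2
    linarith
  exact hdec.trans (by linarith)

/-- ★★★ **THE SAME WITH AN ADDITIVE MINIMALITY SLACK** (LEAD ★w1 g8 06:02:29Z «TWIST SLACK»: the twisted minimiser is an ALMOST-minimiser of the flat energy,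
`E(u;Q_r) ≤ E(w;Q_r) + sl`): identical conclusion with `+ sl` inside the bracket, i.e. `+ 2·sl` overall (✓`minimality_split_of_slack`; the slack rides in the `Λ` of
✓`energy_decay_of_comparison`). [folklore] [cite: SchoenUhlenbeck1982, §4] -/
theorem oneStep_fixedGeometry_of_slack [FiniteDimensional ℝ V] (hd : 0 < d) (u c : Zd d → V) (σ : Zd d → ℤ) (z : Zd d) {r r' R Rin s : ℤ}
    (hu : ∀ y, ‖u y‖ = 1) (hc : ∀ y, c y = (((box y (σ y)).card : ℝ))⁻¹ • ∑ w ∈ box y (σ y), u w)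
    (hσ0 : ∀ y, 0 ≤ σ y) (hσL : ∀ y, ∀ μ : Fin d, |σ (y + unitVec μ) - σ y| ≤ 1) {A B : ℕ} (hA : 1 ≤ A)
    (hσC : ∀ x x' y : Zd d, y ∈ box x (σ x + 2) → y ∈ box x' (σ x' + 2) → σ x ≤ (A : ℤ) * σ x' + B)
    (hσband : ∀ y, σ y ≠ 0 → Rin + 4 ≤ ((Finset.univ.sup fun j => (y j - z j).natAbs : ℕ) : ℤ) ∧ ((Finset.univ.sup fun j => (y j - z j).natAbs : ℕ) : ℤ) ≤ r' - 4)
    (hσbox : ∀ y, Rin + 3 ≤ ((Finset.univ.sup fun j => (y j - z j).natAbs : ℕ) : ℤ) → ((Finset.univ.sup fun j => (y j - z j).natAbs : ℕ) : ℤ) ≤ r' - 3 →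
      box y (σ y + 2) ⊆ box z (r' - 1) \ box z Rin)
    (hσring : ∀ y, ((Finset.univ.sup fun j => (y j - z j).natAbs : ℕ) : ℤ) = R → σ y = s) (hs : 0 ≤ s)
    (hR1 : 1 ≤ R) (hRr' : R ≤ r') (hr'r : r' ≤ r)
    {sl : ℝ} (hminU : ∀ w : Zd d → V, (∀ y, ‖w y‖ = 1) → (∀ y ∉ box z (r - 1), w y = u y) →
      ∑ y ∈ box z r, ∑ μ, ‖u (y + unitVec μ) - u y‖ ^ 2 ≤ ∑ y ∈ box z r, ∑ μ, ‖w (y + unitVec μ) - w y‖ ^ 2 + sl)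
    (hhalf : ∀ y, (1 / 2 : ℝ) ≤ ‖c y‖) {m : ℝ} (hm : 0 < m) (hm1 : m ≤ 1)
    (hmc : ∀ y ∈ box z (R + 1), y ∉ box z (R - 1) → m ≤ ‖c y‖)
    (hmH : m ≤ 1 - (2 * d * R * Real.sqrt (((((2 * s + 1 : ℤ) : ℝ) ^ d))⁻¹ * ∑ w ∈ box z (R + s + 1), ∑ μ, ‖u (w + unitVec μ) - u w‖ ^ 2) +
        2 * ((2 * s + 1 : ℤ) : ℝ) * Real.sqrt (d * ((((2 * s + 1 : ℤ) : ℝ) ^ d))⁻¹ * ∑ w ∈ box z (R + s + 1), ∑ μ, ‖u (w + unitVec μ) - u w‖ ^ 2)))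
    {ρ : ℤ} (hρ : 0 ≤ ρ) (hρR : ρ ≤ R - 2) :
    ∑ y ∈ box z ρ, ∑ μ, ‖u (y + unitVec μ) - u y‖ ^ 2 ≤
      2 * ((2 : ℝ) ^ d * (1 + 56 * d) ^ d * (8 * ((d : ℝ) + 1)) ^ (d + 1) * (((ρ : ℝ) + 1) / (((R - 2 : ℤ) : ℝ) + 1)) ^ d) *
          ∑ y ∈ box z R, ∑ μ, ‖u (y + unitVec μ) - u y‖ ^ 2 +
        2 * (sl + 4 * ((d : ℝ) * ((2 + 4 * (d : ℝ)) ^ 2 * d * (21 : ℝ) ^ d) * ((A : ℝ) + B + 1) ^ d) * ∑ y ∈ box z (r' - 1) \ box z Rin, ∑ μ, ‖u (y + unitVec μ) - u y‖ ^ 2 +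
          ((m ^ 2)⁻¹ - 1) * ∑ y ∈ box z R, ∑ μ, ‖u (y + unitVec μ) - u y‖ ^ 2 +
          (m ^ 2)⁻¹ * (2 * Real.sqrt ((∑ y ∈ box z R, ∑ μ, ‖u (y + unitVec μ) - u y‖ ^ 2) *
              ((2 * ((d : ℝ) * ((2 + 4 * (d : ℝ)) ^ 2 * d * (21 : ℝ) ^ d) * ((A : ℝ) + B + 1) ^ d) + 2) *
                ∑ y ∈ box z (r' - 1) \ box z Rin, ∑ μ, ‖u (y + unitVec μ) - u y‖ ^ 2)) +
            (2 * ((d : ℝ) * ((2 + 4 * (d : ℝ)) ^ 2 * d * (21 : ℝ) ^ d) * ((A : ℝ) + B + 1) ^ d) + 2) *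
              ∑ y ∈ box z (r' - 1) \ box z Rin, ∑ μ, ‖u (y + unitVec μ) - u y‖ ^ 2)) := by
  classical
  -- names
  set D : Zd d → ℤ := fun y => ((Finset.univ.sup fun j => (y j - z j).natAbs : ℕ) : ℤ) with hD
  set U : Finset (Zd d) := box z (r' - 1) \ box z Rin with hU
  set EU : ℝ := ∑ y ∈ U, ∑ μ, ‖u (y + unitVec μ) - u y‖ ^ 2 with hEU
  set ER : ℝ := ∑ y ∈ box z R, ∑ μ, ‖u (y + unitVec μ) - u y‖ ^ 2 with hER
  set Cst : ℝ := (d : ℝ) * ((2 + 4 * (d : ℝ)) ^ 2 * d * (21 : ℝ) ^ d) * ((A : ℝ) + B + 1) ^ d with hCst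
  have hCst0 : 0 ≤ Cst := by positivity
  have hEU0 : 0 ≤ EU := Finset.sum_nonneg fun _ _ => Finset.sum_nonneg fun _ _ => by positivity
  have hER0 : 0 ≤ ER := Finset.sum_nonneg fun _ _ => Finset.sum_nonneg fun _ _ => by positivity
  -- (a) radius zero ⇒ `c = u`; hence `c ≠ u ⇒ σ ≠ 0`
  have hcu0 : ∀ y, σ y = 0 → c y = u y := fun y hy => by rw [hc y]; exact mean_eq_self_of_radius_eq_zero u y hy
  have hσ_of_ne : ∀ y, c y ≠ u y → σ y ≠ 0 := fun y hne h0 => hne (hcu0 y h0)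
  -- (b) `c = u` off `Q_{r−1}(z)`
  have hcu : ∀ y ∉ box z (r - 1), c y = u y := by
    intro y hy
    apply hcu0
    by_contra hne
    have hb := hσband y hne
    change Rin + 4 ≤ D y ∧ D y ≤ r' - 4 at hb
    have : ¬ D y ≤ r - 1 := fun h => hy ((mem_box_iff_sup_le hd y z (r - 1)).2 h)
    omega
  -- (c) the band of points where `c ≠ u` at the point or a forward neighbour
  have hband : ∀ y, (c y ≠ u y ∨ ∃ μ : Fin d, c (y + unitVec μ) ≠ u (y + unitVec μ)) → Rin + 3 ≤ D y ∧ D y ≤ r' - 3 := by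
    intro y hP
    rcases hP with h | ⟨μ, h⟩
    · have hb := hσband y (hσ_of_ne y h)
      change Rin + 4 ≤ D y ∧ D y ≤ r' - 4 at hb
      omega
    · have hb := hσband (y + unitVec μ) (hσ_of_ne _ h)
      change Rin + 4 ≤ D (y + unitVec μ) ∧ D (y + unitVec μ) ≤ r' - 4 at hb
      have hmem : y + unitVec μ ∈ box y 1 := by
        have := add_unitVec_mem_box (self_mem_box y le_rfl) μ; simpa using this
      have hdiff := abs_sup_sub_sup_le_of_mem_box hd z hmem
      rw [abs_le] at hdiff
      change -1 ≤ D y - D (y + unitVec μ) ∧ D y - D (y + unitVec μ) ≤ 1 at hdiff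
      omega
  -- (d) the harmonic extensions
  obtain ⟨H, hHc, hH⟩ := exists_vec_harmonic_extension hd z (R - 1) c
  obtain ⟨h', hh'u, hh'⟩ := exists_vec_harmonic_extension hd z (R - 1) u
  -- (e) ring points have `D = R`, hence `σ = s` and `c = ū_s`
  have hringD : ∀ y ∈ box z R, y ∉ box z (R - 1) → D y = R := by
    intro y hy hy'
    have h1 := (mem_box_iff_sup_le hd y z R).1 hy
    have h2 : ¬ D y ≤ R - 1 := fun h => hy' ((mem_box_iff_sup_le hd y z (R - 1)).2 h)
    change D y ≤ R at h1
    omega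
  have hringH : ∀ y ∈ box z R, y ∉ box z (R - 1) → H y = (((box y s).card : ℝ))⁻¹ • ∑ w ∈ box y s, u w := by
    intro y hy hy'
    rw [hHc y hy', hc y, hσring y (hringD y hy hy')]
  -- (f) `‖H‖ ≥ m` on `Q_R(z)` and on its forward neighbours
  have hmin_int : ∀ x ∈ box z R, m ≤ ‖H x‖ := by
    intro x hx
    have h := norm_harmonicExt_ge_of_ring hd u H z hR1 hs (fun y _ => hu y) hH hringH hx
    exact hmH.trans h
  have hmQ' : ∀ y ∈ box z R, ∀ μ : Fin d, m ≤ ‖H (y + unitVec μ)‖ := by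
    intro y hy μ
    by_cases hin : y + unitVec μ ∈ box z R
    · exact hmin_int _ hin
    · have hnot : y + unitVec μ ∉ box z (R - 1) := fun h => hin (box_mono z (by linarith) h)
      rw [hHc _ hnot]
      refine hmc _ ?_ hnot
      exact add_unitVec_mem_box hy μ
  have hH0 : ∀ y, H y ≠ 0 := by
    intro y
    by_cases hy : y ∈ box z R
    · have := hmin_int y hy
      intro h0; rw [h0, norm_zero] at this; linarith
    · have hnot : y ∉ box z (R - 1) := fun h => hy (box_mono z (by linarith) h)
      rw [hHc y hnot]
      intro h0; have := hhalf y; rw [h0, norm_zero] at this; linarith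
  -- (g) minimality split
  have hRr : R ≤ r := hRr'.trans hr'r
  have hsplit := minimality_split_of_slack u c H z hRr hu hminU hH0 hHc hcu
  -- (h) layer cost
  set Pout : Zd d → Prop := fun y => c y ≠ u y ∨ ∃ μ : Fin d, c (y + unitVec μ) ≠ u (y + unitVec μ) with hPout
  set Xout : Finset (Zd d) := (box z r \ box z R).filter Pout with hXout
  have hXsub : Xout ⊆ box z r \ box z R := Finset.filter_subset _ _
  have hcuX : ∀ y ∈ (box z r \ box z R) \ Xout, c y = u y ∧ ∀ μ : Fin d, c (y + unitVec μ) = u (y + unitVec μ) := by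
    intro y hy
    rw [Finset.mem_sdiff, hXout, Finset.mem_filter] at hy
    have hP : ¬ Pout y := fun h => hy.2 ⟨hy.1, h⟩
    simp only [hPout, not_or, not_exists, not_not] at hP
    exact hP
  have hΛ := layer_cost_le_four_mul u c z hu Xout hXsub hcuX (fun y _ => hhalf y) (fun y _ μ => hhalf _)
  -- boxes of `Xout` and of `T` lie in `U`
  have hUX : ∀ y ∈ Xout, box y (σ y + 2) ⊆ U := by
    intro y hy
    rw [hXout, Finset.mem_filter] at hy
    have hb := hband y hy.2
    exact hσbox y hb.1 hb.2
  have hmollX := energy_mollifier_le u σ hσ0 A B hA hσC Xout U (fun y _ μ => hσL y μ) hUX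
  -- rewrite the mollifier sums as `c`
  have hcE : ∀ S : Finset (Zd d), ∑ x ∈ S, ∑ μ, ‖(((box (x + unitVec μ) (σ (x + unitVec μ))).card : ℝ))⁻¹ • ∑ y ∈ box (x + unitVec μ) (σ (x + unitVec μ)), u y -
        (((box x (σ x)).card : ℝ))⁻¹ • ∑ y ∈ box x (σ x), u y‖ ^ 2 = ∑ x ∈ S, ∑ μ, ‖c (x + unitVec μ) - c x‖ ^ 2 := by
    intro S
    refine Finset.sum_congr rfl fun x _ => Finset.sum_congr rfl fun μ _ => ?_
    rw [hc (x + unitVec μ), hc x]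
  rw [hcE] at hmollX
  have hΛ' : ∑ y ∈ box z r \ box z R, ∑ μ, ‖(‖c (y + unitVec μ)‖)⁻¹ • c (y + unitVec μ) - (‖c y‖)⁻¹ • c y‖ ^ 2 -
      ∑ y ∈ box z r \ box z R, ∑ μ, ‖u (y + unitVec μ) - u y‖ ^ 2 ≤ 4 * Cst * EU := by
    calc _ ≤ 4 * ∑ y ∈ Xout, ∑ μ, ‖c (y + unitVec μ) - c y‖ ^ 2 := hΛ
      _ ≤ 4 * (Cst * EU) := by linarith [hmollX]
      _ = 4 * Cst * EU := by ring
  -- (i) the `X`-slot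
  set T : Finset (Zd d) := (box z R).filter Pout with hT
  have hTmem : ∀ y ∈ box z R, Pout y → y ∈ T := fun y hy hP => by rw [hT, Finset.mem_filter]; exact ⟨hy, hP⟩
  have hXsplit := energy_sub_le_on_support c u (box z R) T hTmem
  have hUT : ∀ y ∈ T, box y (σ y + 2) ⊆ U := by
    intro y hy
    rw [hT, Finset.mem_filter] at hy
    have hb := hband y hy.2
    exact hσbox y hb.1 hb.2
  have hmollT := energy_mollifier_le u σ hσ0 A B hA hσC T U (fun y _ μ => hσL y μ) hUT
  rw [hcE] at hmollT
  have hTU : T ⊆ U := by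
    intro y hy
    rw [hT, Finset.mem_filter] at hy
    have hb := hband y hy.2
    rw [hU, Finset.mem_sdiff, mem_box_iff_sup_le hd, mem_box_iff_sup_le hd]
    change D y ≤ r' - 1 ∧ ¬ D y ≤ Rin
    omega
  have huT : ∑ y ∈ T, ∑ μ, ‖u (y + unitVec μ) - u y‖ ^ 2 ≤ EU :=
    Finset.sum_le_sum_of_subset_of_nonneg hTU fun _ _ _ => Finset.sum_nonneg fun _ _ => by positivity
  have hX' : ∑ y ∈ box z R, ∑ μ, ‖(c (y + unitVec μ) - u (y + unitVec μ)) - (c y - u y)‖ ^ 2 ≤ (2 * Cst + 2) * EU := by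
    calc _ ≤ _ := hXsplit
      _ ≤ 2 * (Cst * EU) + 2 * EU := by linarith [hmollT, huT]
      _ = (2 * Cst + 2) * EU := by ring
  -- (j) the decay from the comparison, then monotonicity in `Λ` and `X`
  have hdec := energy_decay_of_comparison u c h' H z hρ hρR hm hm1 hh' hh'u hH hHc hmin_int hmQ' hsplit
  set X : ℝ := ∑ y ∈ box z R, ∑ μ, ‖(c (y + unitVec μ) - u (y + unitVec μ)) - (c y - u y)‖ ^ 2 with hX
  have hX0 : 0 ≤ X := Finset.sum_nonneg fun _ _ => Finset.sum_nonneg fun _ _ => by positivity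
  have hm2 : 0 ≤ (m ^ 2)⁻¹ := by positivity
  have hsqrt : Real.sqrt (ER * X) ≤ Real.sqrt (ER * ((2 * Cst + 2) * EU)) := Real.sqrt_le_sqrt (mul_le_mul_of_nonneg_left hX' hER0)
  have hmono : (∑ y ∈ box z r \ box z R, ∑ μ, ‖(‖c (y + unitVec μ)‖)⁻¹ • c (y + unitVec μ) - (‖c y‖)⁻¹ • c y‖ ^ 2 -
        ∑ y ∈ box z r \ box z R, ∑ μ, ‖u (y + unitVec μ) - u y‖ ^ 2 + sl) +
      ((m ^ 2)⁻¹ - 1) * ER + (m ^ 2)⁻¹ * (2 * Real.sqrt (ER * X) + X) ≤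
      (sl + 4 * Cst * EU) + ((m ^ 2)⁻¹ - 1) * ER + (m ^ 2)⁻¹ * (2 * Real.sqrt (ER * ((2 * Cst + 2) * EU)) + (2 * Cst + 2) * EU) := by
    have h1 : (m ^ 2)⁻¹ * (2 * Real.sqrt (ER * X) + X) ≤ (m ^ 2)⁻¹ * (2 * Real.sqrt (ER * ((2 * Cst + 2) * EU)) + (2 * Cst + 2) * EU) :=
      mul_le_mul_of_nonneg_left (by linarith) hm2
    linarith
  exact hdec.trans (by linarith)

end Summit.QuantumFields.YangMills.Theorems.PoincareLipschitzSphereMapOneStepFixedGeometry
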